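import Literature.NumberTheory.ModularForms.SiegelCuspFormsLevelDegreeOneFiniteCharacter
import HarnessLib

/-!
# The degree-one dictionary for an ARBITRARY finite character: `𝔐_k(K, χ) ≃ₗ[ℂ] {f ∈ M_k(Γ(K, χ)) : f ∣[k] γ = χ(γ)·f ∀ γ ∈ K}`
# and `𝔑_k(K, χ) ≃ₗ[ℂ] {f ∈ S_k(Γ(K, χ)) : f ∣[k] γ = χ(γ)·f ∀ γ ∈ K}` (A–Z Ch. 2 §2.2 (2.4), §3.5 (3.67) vs Mathlib's
# `ModularForm` ∕ `CuspForm`; D–S §4.3's `M_k(N, χ)` pattern for a general pair `(K, χ)`)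

Layer `Literature/NumberTheory/ModularForms`, namespace `Literature.NumberTheory.ModularForms.SiegelModularForm` (lane
`lit-hodgefound`, Layer A2, seat `lit-hodgefound-skel-2`, row A2-277; on A2-274 `SiegelCuspFormsLevelDegreeOneFiniteCharacter`
(`cuspLevelSpaceChar K k χ = 𝔑_k(K, χ)`), A2-273 (`kerSL K χ = Γ(K, χ)`, `forall_mem_kerSL`, `finiteIndex_kerSL`), A2-270 (the pattern:
`levelSpaceNebentypusEquiv` for `K = Γ₀¹(N)`, `χ∘det D`, with `Γ₁(N)` in place of `Γ(K, χ)`), A2-264 (`slash_toUHPFun_eq_smul` = (2.4) in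
slash language), A2-261 (`levelSpace`, `levelSpaceOneEquiv` = the case `χ = 1`, `isSiegelModularFormLevel_ofUHPFun`), A2-258 (`toModularForm`),
A2-263 (`toCuspForm` pattern), p16 (`ofUHPFun`, `toUHPFun`, `one1`, `toUHP`)).  Definitions with bodies (`modularFormCharSubspace`,
`levelSpaceCharEquiv`, `cuspFormCharSubspace`, `toCuspFormOfMem`, `cuspLevelSpaceCharEquiv`) and theorems; no named fact, no instance.

Source.  A–Z Ch. 2 §2.2 (p0064): `F ∈ 𝔐_k(K, χ)` iff (1) holomorphic on `H_1`, (2) `det(CZ + D)^{−k}F(M⟨Z⟩) = χ(M)F(Z)` for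
`M ∈ K`, (3) (n = 1) `(cz + d)^{−k}F(γz)` bounded on the regions `H_1(ε)` for all `γ ∈ Γ¹`; §3.5 (3.67) (p0079): cusp forms.  D–S §4.3
(p. 119): `M_k(N, χ) = {f ∈ M_k(Γ₁(N)) : f[γ]_k = χ(d_γ)f for all γ ∈ Γ₀(N)}` — the model: a space with character `χ` for `K` is the
`χ`-eigenspace, under `K`, of the forms for a finite-index subgroup on which `χ` is trivial.  For a general finite-index `K ≤ Γ¹` and a
character `χ` of finite order the natural such subgroup is A2-273's `Γ(K, χ) = K ∩ ker χ` (finite index), and this file proves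
`𝔐_k(K, χ) ≅ M_k(Γ(K, χ))^{(K, χ)}` and `𝔑_k(K, χ) ≅ S_k(Γ(K, χ))^{(K, χ)}` as ℂ-linear isomorphisms (`F ↦ (τ ↦ F((τ)))`, inverse
`g ↦ (Z ↦ g(Z₀₀))` cut off outside `𝔥_1`).

## What is here (degree one)

* §1 DEF **`modularFormCharSubspace K k χ ≤ ModularForm Γ(K, χ) k`** (`{f : f ∣[k] γ = χ(γ)·f ∀ γ ∈ K}`), `mem_modularFormCharSubspace_iff`,
  **`modularFormCharSubspace_one_eq_top`** (`χ = 1`: no condition).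
* §2 `IsSiegelModularFormLevel.toModularForm_mem_modularFormCharSubspace` ((2.4) ⇒ the eigen-condition, A2-264),
  **`isSiegelModularFormLevel_ofUHPFun_of_slash_eq_smul`** (conversely, for any `ModularFormClass` element with the eigen-condition).
* §3 DEF **`levelSpaceCharEquiv K k χ : levelSpace K k χ ≃ₗ[ℂ] modularFormCharSubspace K k χ`** (for `Γ(K, χ)` of finite index, e.g.
  `K` finite index and `χ^m = 1`), `levelSpaceCharEquiv_apply`, `coe_levelSpaceCharEquiv_symm_apply`, **`finrank_levelSpace_eq_finrank_modularFormCharSubspace`**.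
* §4 DEF **`cuspFormCharSubspace K k χ ≤ CuspForm Γ(K, χ) k`**, DEF `toCuspFormOfMem` (an element of `𝔑_k(K, χ)` as a Mathlib cusp form on
  `Γ(K, χ)` — zero at all cusps from D–S's condition (4)), `isZeroAtImInfty_slash_ofUHPFun` , DEF **`cuspLevelSpaceCharEquiv K k χ :
  cuspLevelSpaceChar K k χ ≃ₗ[ℂ] cuspFormCharSubspace K k χ`**, `finrank_cuspLevelSpaceChar_eq_finrank_cuspFormCharSubspace`.

NOT here: degree `n ≥ 2`; characters of infinite order (then `Γ(K, χ)` may have infinite index and Mathlib's `ModularForm Γ(K, χ) k` is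
not the right object).

## References

* [AndrianovZhuravlev2015] A. N. Andrianov, V. G. Zhuravlev, *Modular Forms and Hecke Operators*, Transl. Math. Monogr. 145, AMS, Ch. 2
  §2.2 (2.4) and conditions (1)–(3) (p0063–p0064); §3.5 (3.67) (p0079).
* [DiamondShurman2005] F. Diamond, J. Shurman, *A First Course in Modular Forms*, GTM 228, §4.3 (p. 119, "M_k(N, χ)"); Definition 1.2.3
  (p0027).
-/

noncomputable section

open Complex Real Matrix Set Filter Topology
open scoped MatrixGroups ModularForm Manifold

namespace Literature.NumberTheory.ModularForms

namespace SiegelModularForm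

open Literature.NumberTheory.Automorphic (siegelUpperHalfSpace)
open Literature.NumberTheory.ModularForms.SiegelUpperHalfSpace
open UpperHalfPlane hiding I

/-! ### §1 The `(K, χ)`-eigenspace of `M_k(Γ(K, χ))` -/

section Subspace

variable (K : Subgroup (Matrix.symplecticGroup (Fin 1) ℤ)) (k : ℤ) (χ : K →* ℂ)

/-- **`M_k(Γ(K, χ))^{(K, χ)} = {f ∈ M_k(Γ(K, χ)) : f ∣[k] γ = χ(γ)·f for all γ ∈ K}`** — Diamond–Shurman's recipe
«`M_k(N, χ) = {f ∈ M_k(Γ₁(N)) : f[γ]_k = χ(d_γ)f for all γ ∈ Γ₀(N)}`» for a general pair `(K, χ)`, with A2-273's `Γ(K, χ) = K ∩ ker χ`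
in place of `Γ₁(N)`. [cite: DiamondShurman2005, §4.3 (p. 119, "M_k(N, χ) = {f ∈ M_k(Γ₁(N)) : f[γ]_k = χ(d_γ)f for all γ ∈ Γ₀(N)}")] [cite: AndrianovZhuravlev2015, Ch. 2 §2.2 (2.4) (p0064)] -/
def modularFormCharSubspace : Submodule ℂ (ModularForm (kerSL K χ) k) where
  carrier := {f | ∀ (γ : SL(2, ℤ)) (h : symplecticGroupFinOneEquiv.symm γ ∈ K),
    (⇑f : ℍ → ℂ) ∣[k] γ = χ ⟨symplecticGroupFinOneEquiv.symm γ, h⟩ • (⇑f : ℍ → ℂ)}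
  add_mem' {f g} hf hg γ h := by
    rw [ModularForm.coe_add, SlashAction.add_slash, hf γ h, hg γ h, smul_add]
  zero_mem' γ h := by
    rw [ModularForm.coe_zero, SlashAction.zero_slash, smul_zero]
  smul_mem' c {f} hf γ h := by
    show (⇑(c • f) : ℍ → ℂ) ∣[k] γ = _
    rw [ModularForm.IsGLPos.coe_smul, ModularForm.SL_smul_slash, hf γ h, smul_comm]

variable {K k χ}

/-- Membership in the eigenspace. [cite: DiamondShurman2005, §4.3 (p. 119)] -/
theorem mem_modularFormCharSubspace_iff {f : ModularForm (kerSL K χ) k} :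
    f ∈ modularFormCharSubspace K k χ ↔ ∀ (γ : SL(2, ℤ)) (h : symplecticGroupFinOneEquiv.symm γ ∈ K),
      (⇑f : ℍ → ℂ) ∣[k] γ = χ ⟨symplecticGroupFinOneEquiv.symm γ, h⟩ • (⇑f : ℍ → ℂ) :=
  Iff.rfl

variable (K k) in
/-- **For the trivial character there is no condition**: `M_k(Γ(K, 1))^{(K, 1)} = M_k(Γ(K, 1))` (`Γ(K, 1)` is `K` itself, on which every
form of `M_k(Γ(K, 1))` is invariant) — A2-261's `levelSpaceOneEquiv` case. [cite: AndrianovZhuravlev2015, Ch. 2 §2.2 ("𝔐_k^n = 𝔐_k(Γⁿ, 1)") (p0064)] -/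
theorem modularFormCharSubspace_one_eq_top : modularFormCharSubspace K k (1 : K →* ℂ) = ⊤ := by
  rw [eq_top_iff]
  intro f _ γ h
  rw [MonoidHom.one_apply, one_smul]
  have hγ : γ ∈ kerSL K (1 : K →* ℂ) := mem_kerSL_iff.2 ⟨h, rfl⟩
  exact SlashInvariantFormClass.slash_action_eq f (Matrix.SpecialLinearGroup.mapGL ℝ γ) (Subgroup.mem_map_of_mem _ hγ)

end Subspace

/-! ### §2 (2.4) ⇔ the eigen-condition -/

section Transfer

variable {K : Subgroup (Matrix.symplecticGroup (Fin 1) ℤ)} {k : ℤ} {χ : K →* ℂ} {F : Matrix (Fin 1) (Fin 1) ℂ → ℂ}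

/-- **`F ∈ 𝔐_k(K, χ)` ⇒ `(τ ↦ F((τ)))` lies in the `(K, χ)`-eigenspace of `M_k(Γ(K, χ))`**: (2.4) in slash language is
`F((·)) ∣[k] γ = χ(γ)·F((·))` for `γ ∈ K` (A2-264 `slash_toUHPFun_eq_smul`). [cite: AndrianovZhuravlev2015, Ch. 2 §2.2 (2.4) (p0064)] [cite: DiamondShurman2005, §4.3 (p. 119)] -/
theorem IsSiegelModularFormLevel.toModularForm_mem_modularFormCharSubspace [(kerSL K χ).FiniteIndex]
    (hF : IsSiegelModularFormLevel K k χ F) :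
    hF.toModularForm (kerSL K χ) (forall_mem_kerSL K χ) ∈ modularFormCharSubspace K k χ :=
  fun _ h => hF.slash_toUHPFun_eq_smul h

/-- **Conversely**: a Mathlib modular-form-class object `g` on a finite-index `Γ ≤ SL₂(ℤ)` with `g ∣[k] γ = χ(γ)·g` for all `γ ∈ K` gives
`(Z ↦ g(Z₀₀)) ∈ 𝔐_k(K, χ)` — holomorphy (1) and boundedness (3) are those of `g` (A2-261 `isSiegelModularFormLevel_ofUHPFun`), and (2) for
`M ∈ K` is the eigen-condition evaluated at `τ`: `g(γτ)(cτ + d)^{−k} = χ(γ)g(τ)`. [cite: AndrianovZhuravlev2015, Ch. 2 §2.2 (2.4), conditions (1)–(3) (p0063–p0064)] [cite: DiamondShurman2005, §4.3 (p. 119)] -/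
theorem isSiegelModularFormLevel_ofUHPFun_of_slash_eq_smul {Γ : Subgroup SL(2, ℤ)} [Γ.FiniteIndex] {E : Type*} [FunLike E ℍ ℂ]
    [ModularFormClass E Γ k] (g : E)
    (hg : ∀ (γ : SL(2, ℤ)) (h : symplecticGroupFinOneEquiv.symm γ ∈ K),
      (⇑g : ℍ → ℂ) ∣[k] γ = χ ⟨symplecticGroupFinOneEquiv.symm γ, h⟩ • (⇑g : ℍ → ℂ)) :
    IsSiegelModularFormLevel K k χ (ofUHPFun g) where
  differentiableOn := (isSiegelModularFormLevel_ofUHPFun g).differentiableOn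
  transform M Z hZ := by
    set γ : SL(2, ℤ) := symplecticGroupFinOneEquiv (M : Matrix.symplecticGroup (Fin 1) ℤ) with hγdef
    have hMγ' : symplecticGroupFinOneEquiv.symm γ = (M : Matrix.symplecticGroup (Fin 1) ℤ) := by
      rw [hγdef, MulEquiv.symm_apply_apply]
    have hMK : symplecticGroupFinOneEquiv.symm γ ∈ K := by rw [hMγ']; exact M.2
    have hMγ : ((M : Matrix.symplecticGroup (Fin 1) ℤ) : Matrix (Fin 1 ⊕ Fin 1) (Fin 1 ⊕ Fin 1) ℤ) = spOfSL γ := by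
      rw [← coe_symplecticGroupFinOneEquiv_symm γ, hMγ']
    have hχM : χ M = χ ⟨symplecticGroupFinOneEquiv.symm γ, hMK⟩ := by
      congr 1
      exact Subtype.ext hMγ'.symm
    set τ := toUHP Z hZ with hτ
    have hZτ : Z = one1 (τ : ℂ) := (one1_toUHP hZ).symm
    rw [hχM, hZτ, hMγ, moeb_spOfSL, det_denom_spOfSL, ofUHPFun_one1, ofUHPFun_one1]
    have h := congr_fun (hg γ hMK) τ
    rw [ModularForm.SL_slash_apply, Pi.smul_apply, smul_eq_mul] at h
    have hd : UpperHalfPlane.denom (γ : GL (Fin 2) ℝ) τ ≠ 0 := UpperHalfPlane.denom_ne_zero _ τ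
    calc g (γ • τ) = g (γ • τ) * UpperHalfPlane.denom (γ : GL (Fin 2) ℝ) τ ^ (-k) *
          UpperHalfPlane.denom (γ : GL (Fin 2) ℝ) τ ^ k := by
            rw [mul_assoc, ← zpow_add₀ hd, neg_add_cancel, zpow_zero, mul_one]
      _ = χ ⟨symplecticGroupFinOneEquiv.symm γ, hMK⟩ * g τ * UpperHalfPlane.denom (γ : GL (Fin 2) ℝ) τ ^ k := by rw [h]
      _ = χ ⟨symplecticGroupFinOneEquiv.symm γ, hMK⟩ * UpperHalfPlane.denom (γ : GL (Fin 2) ℝ) τ ^ k * g τ := by ring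
  bounded_of_eq_one := (isSiegelModularFormLevel_ofUHPFun g).bounded_of_eq_one

/-- On `ℍ` the cut-off plays no role: `τ ↦ ((𝔥_1-indicator of Z ↦ g(Z₀₀)))((τ)) = g`. [cite: AndrianovZhuravlev2015, Ch. 2 §2.2 (p0063)] -/
theorem toUHPFun_indicator_ofUHPFun {E : Type*} [FunLike E ℍ ℂ] (g : E) :
    toUHPFun ((siegelUpperHalfSpace 1).indicator (ofUHPFun g)) = ⇑g := by
  funext τ
  rw [toUHPFun_apply, Set.indicator_of_mem (one1_coe_mem τ), ofUHPFun_one1]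

end Transfer

/-! ### §3 `𝔐_k(K, χ) ≃ₗ[ℂ] M_k(Γ(K, χ))^{(K, χ)}` -/

section Equiv

variable (K : Subgroup (Matrix.symplecticGroup (Fin 1) ℤ)) (k : ℤ) (χ : K →* ℂ) [(kerSL K χ).FiniteIndex]

/-- **The degree-one dictionary for an arbitrary pair `(K, χ)` with `Γ(K, χ)` of finite index (e.g. `K` of finite index and `χ^m = 1`,
A2-273 `finiteIndex_kerSL`): `𝔐_k(K, χ) ≃ₗ[ℂ] {f ∈ M_k(Γ(K, χ)) : f ∣[k] γ = χ(γ)·f ∀ γ ∈ K}`**, `F ↦ (τ ↦ F((τ)))`, inverse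
`g ↦ (Z ↦ g(Z₀₀))` cut off outside `𝔥_1`.  A2-261's `levelSpaceOneEquiv` (`χ = 1`) and A2-270's `levelSpaceNebentypusEquiv` (`K = Γ₀¹(N)`,
`χ∘det D`, modelled on `Γ₁(N)`) are the two previous instances. [cite: AndrianovZhuravlev2015, Ch. 2 §2.2 ("𝔐_k(K, χ) … is obviously a vector space over C") (p0064)] [cite: DiamondShurman2005, §4.3 (p. 119)] -/
def levelSpaceCharEquiv : levelSpace K k χ ≃ₗ[ℂ] modularFormCharSubspace K k χ where
  toFun F := ⟨(isSiegelModularFormLevel_of_mem_levelSpace F.2).toModularForm (kerSL K χ) (forall_mem_kerSL K χ),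
    (isSiegelModularFormLevel_of_mem_levelSpace F.2).toModularForm_mem_modularFormCharSubspace⟩
  map_add' F G := by
    apply Subtype.ext
    ext τ
    rfl
  map_smul' c F := by
    apply Subtype.ext
    ext τ
    rfl
  invFun g := ⟨(siegelUpperHalfSpace 1).indicator (ofUHPFun (g : ModularForm (kerSL K χ) k)),
    (isSiegelModularFormLevel_ofUHPFun_of_slash_eq_smul (g : ModularForm (kerSL K χ) k) g.2).indicator_mem_levelSpace⟩
  left_inv F := by
    apply Subtype.ext
    funext Z
    change (siegelUpperHalfSpace 1).indicator
        (ofUHPFun ((isSiegelModularFormLevel_of_mem_levelSpace F.2).toModularForm (kerSL K χ) (forall_mem_kerSL K χ))) Z =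
      (F : Matrix (Fin 1) (Fin 1) ℂ → ℂ) Z
    by_cases hZ : Z ∈ siegelUpperHalfSpace 1
    · rw [Set.indicator_of_mem hZ, ofUHPFun_apply_of_mem _ hZ, IsSiegelModularFormLevel.toModularForm_apply, one1_toUHP hZ]
    · rw [Set.indicator_of_notMem hZ, apply_eq_zero_of_mem_levelSpace F.2 hZ]
  right_inv g := by
    apply Subtype.ext
    ext τ
    change (siegelUpperHalfSpace 1).indicator (ofUHPFun (g : ModularForm (kerSL K χ) k)) (one1 (τ : ℂ)) =
      (g : ModularForm (kerSL K χ) k) τ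
    rw [Set.indicator_of_mem (one1_coe_mem τ), ofUHPFun_one1]

variable {K k χ}

/-- The values of `levelSpaceCharEquiv K k χ F`: `τ ↦ F((τ))`. [cite: AndrianovZhuravlev2015, Ch. 2 §2.2 (p0064)] -/
@[simp] theorem levelSpaceCharEquiv_apply (F : levelSpace K k χ) (τ : ℍ) :
    ((levelSpaceCharEquiv K k χ F : modularFormCharSubspace K k χ) : ModularForm (kerSL K χ) k) τ =
      (F : Matrix (Fin 1) (Fin 1) ℂ → ℂ) (one1 (τ : ℂ)) :=
  rfl

/-- The inverse: `g ↦ (Z ↦ g(Z₀₀))` cut off outside `𝔥_1`. [cite: AndrianovZhuravlev2015, Ch. 2 §2.2 (p0064)] -/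
theorem coe_levelSpaceCharEquiv_symm_apply (g : modularFormCharSubspace K k χ) :
    ((levelSpaceCharEquiv K k χ).symm g : Matrix (Fin 1) (Fin 1) ℂ → ℂ) =
      (siegelUpperHalfSpace 1).indicator (ofUHPFun (g : ModularForm (kerSL K χ) k)) :=
  rfl

variable (K k χ) in
/-- **`dim 𝔐_k(K, χ) = dim M_k(Γ(K, χ))^{(K, χ)}`.** [cite: AndrianovZhuravlev2015, Ch. 2 §2.2 (p0064); §4.2 Theorem 4.3 (p0085)] [cite: DiamondShurman2005, §4.3 (p. 119)] -/
theorem finrank_levelSpace_eq_finrank_modularFormCharSubspace :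
    Module.finrank ℂ (levelSpace K k χ) = Module.finrank ℂ (modularFormCharSubspace K k χ) :=
  (levelSpaceCharEquiv K k χ).finrank_eq

variable (K k χ) in
/-- In particular `dim 𝔐_k(K, χ) ≤ dim M_k(Γ(K, χ))`. [cite: AndrianovZhuravlev2015, Ch. 2 §4.2 Theorem 4.3 (p0085)] -/
theorem finrank_levelSpace_le_finrank_modularForm_kerSL :
    Module.finrank ℂ (levelSpace K k χ) ≤ Module.finrank ℂ (ModularForm (kerSL K χ) k) := by
  haveI := Literature.NumberTheory.EllipticCurves.ModularForms.finiteDimensional_modularForm_of_finiteIndex (kerSL K χ) k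
  rw [finrank_levelSpace_eq_finrank_modularFormCharSubspace]
  exact Submodule.finrank_le _

end Equiv

/-! ### §4 Cusp forms: `𝔑_k(K, χ) ≃ₗ[ℂ] S_k(Γ(K, χ))^{(K, χ)}` -/

section Cusp

variable (K : Subgroup (Matrix.symplecticGroup (Fin 1) ℤ)) (k : ℤ) (χ : K →* ℂ)

/-- **`S_k(Γ(K, χ))^{(K, χ)} = {f ∈ S_k(Γ(K, χ)) : f ∣[k] γ = χ(γ)·f for all γ ∈ K}`** (the cusp forms of the eigenspace; D–S's `S_k(N, χ)`
pattern). [cite: DiamondShurman2005, §4.3 (p. 119); Definition 1.2.3 (4) (p0027)] [cite: AndrianovZhuravlev2015, Ch. 2 §3.5 (3.67) ("the cusp-forms in 𝔐_w(K, χ)") (p0079)] -/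
def cuspFormCharSubspace : Submodule ℂ (CuspForm (kerSL K χ) k) where
  carrier := {f | ∀ (γ : SL(2, ℤ)) (h : symplecticGroupFinOneEquiv.symm γ ∈ K),
    (⇑f : ℍ → ℂ) ∣[k] γ = χ ⟨symplecticGroupFinOneEquiv.symm γ, h⟩ • (⇑f : ℍ → ℂ)}
  add_mem' {f g} hf hg γ h := by
    rw [CuspForm.coe_add, SlashAction.add_slash, hf γ h, hg γ h, smul_add]
  zero_mem' γ h := by
    rw [CuspForm.coe_zero, SlashAction.zero_slash, smul_zero]
  smul_mem' c {f} hf γ h := by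
    show (⇑(c • f) : ℍ → ℂ) ∣[k] γ = _
    rw [CuspForm.IsGLPos.coe_smul, ModularForm.SL_smul_slash, hf γ h, smul_comm]

variable {K k χ}

/-- Membership in the cusp eigenspace. [cite: DiamondShurman2005, §4.3 (p. 119)] -/
theorem mem_cuspFormCharSubspace_iff {f : CuspForm (kerSL K χ) k} :
    f ∈ cuspFormCharSubspace K k χ ↔ ∀ (γ : SL(2, ℤ)) (h : symplecticGroupFinOneEquiv.symm γ ∈ K),
      (⇑f : ℍ → ℂ) ∣[k] γ = χ ⟨symplecticGroupFinOneEquiv.symm γ, h⟩ • (⇑f : ℍ → ℂ) :=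
  Iff.rfl

variable [(kerSL K χ).FiniteIndex]

/-- **An element of `𝔑_k(K, χ)` as a Mathlib cusp form on `Γ(K, χ)`**: the modular form `τ ↦ F((τ))` (A2-258) is zero at every cusp
because `F((·)) ∣[k] γ → 0` at `i∞` for all `γ ∈ SL₂(ℤ)` (D–S Definition 1.2.3 (4); A2-263's `toCuspForm` pattern, here directly from
A2-274's definition, with no finite-order hypothesis on `χ`). [cite: DiamondShurman2005, Definition 1.2.3 (4) (p0027)] [cite: AndrianovZhuravlev2015, Ch. 2 §3.5 (3.67) (p0079)] -/
def toCuspFormOfMem {F : Matrix (Fin 1) (Fin 1) ℂ → ℂ} (hF : F ∈ cuspLevelSpaceChar K k χ) : CuspForm (kerSL K χ) k where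
  toSlashInvariantForm := ((isSiegelModularFormLevel_of_mem_levelSpace hF.1).toModularForm (kerSL K χ)
    (forall_mem_kerSL K χ)).toSlashInvariantForm
  holo' := ((isSiegelModularFormLevel_of_mem_levelSpace hF.1).toModularForm (kerSL K χ) (forall_mem_kerSL K χ)).holo'
  zero_at_cusps' {c} hc := by
    rw [Subgroup.IsArithmetic.isCusp_iff_isCusp_SL2Z] at hc
    rw [OnePoint.isZeroAt_iff_forall_SL2Z hc]
    intro γ _
    exact hF.2 γ

/-- The values of `toCuspFormOfMem hF`: `τ ↦ F((τ))`. [cite: AndrianovZhuravlev2015, Ch. 2 §3.5 (p0079)] -/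
@[simp] theorem toCuspFormOfMem_apply {F : Matrix (Fin 1) (Fin 1) ℂ → ℂ} (hF : F ∈ cuspLevelSpaceChar K k χ) (τ : ℍ) :
    toCuspFormOfMem hF τ = F (one1 (τ : ℂ)) :=
  rfl

/-- The cusp form of `F ∈ 𝔑_k(K, χ)` lies in the cusp eigenspace ((2.4) in slash language). [cite: AndrianovZhuravlev2015, Ch. 2 §2.2 (2.4) (p0064)] [cite: DiamondShurman2005, §4.3 (p. 119)] -/
theorem toCuspFormOfMem_mem {F : Matrix (Fin 1) (Fin 1) ℂ → ℂ} (hF : F ∈ cuspLevelSpaceChar K k χ) :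
    toCuspFormOfMem hF ∈ cuspFormCharSubspace K k χ :=
  fun _ h => (isSiegelModularFormLevel_of_mem_levelSpace hF.1).slash_toUHPFun_eq_smul h

/-- Conversely, a Mathlib cusp form `g` in the eigenspace gives an element of `𝔑_k(K, χ)`: `Z ↦ g(Z₀₀)` cut off outside `𝔥_1`
(§2 for the `𝔐`-part; `g ∣[k] γ → 0` at `i∞` for all `γ`, Mathlib `CuspFormClass.zero_at_infty_slash`).
[cite: DiamondShurman2005, Definition 1.2.3 (4) (p0027)] [cite: AndrianovZhuravlev2015, Ch. 2 §3.5 (3.67) (p0079)] -/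
theorem indicator_ofUHPFun_mem_cuspLevelSpaceChar (g : cuspFormCharSubspace K k χ) :
    (siegelUpperHalfSpace 1).indicator (ofUHPFun (g : CuspForm (kerSL K χ) k)) ∈ cuspLevelSpaceChar K k χ := by
  refine ⟨(isSiegelModularFormLevel_ofUHPFun_of_slash_eq_smul (g : CuspForm (kerSL K χ) k) g.2).indicator_mem_levelSpace,
    fun γ => ?_⟩
  rw [toUHPFun_indicator_ofUHPFun]
  exact CuspFormClass.zero_at_infty_slash (g : CuspForm (kerSL K χ) k) γ

variable (K k χ)

/-- **`𝔑_k(K, χ) ≃ₗ[ℂ] {f ∈ S_k(Γ(K, χ)) : f ∣[k] γ = χ(γ)·f ∀ γ ∈ K}`** (`Γ(K, χ)` of finite index), `F ↦ (τ ↦ F((τ)))`, inverse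
`g ↦ (Z ↦ g(Z₀₀))` cut off outside `𝔥_1` — A2-265's `cuspLevelSpaceOneEquiv` is the case `χ = 1`.
[cite: AndrianovZhuravlev2015, Ch. 2 §3.5 (3.67) (p0079)] [cite: DiamondShurman2005, §4.3 (p. 119); Definition 1.2.3 (4) (p0027)] -/
def cuspLevelSpaceCharEquiv : cuspLevelSpaceChar K k χ ≃ₗ[ℂ] cuspFormCharSubspace K k χ where
  toFun F := ⟨toCuspFormOfMem F.2, toCuspFormOfMem_mem F.2⟩
  map_add' F G := by
    apply Subtype.ext
    ext τ
    rfl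
  map_smul' c F := by
    apply Subtype.ext
    ext τ
    rfl
  invFun g := ⟨(siegelUpperHalfSpace 1).indicator (ofUHPFun (g : CuspForm (kerSL K χ) k)), indicator_ofUHPFun_mem_cuspLevelSpaceChar g⟩
  left_inv F := by
    apply Subtype.ext
    funext Z
    change (siegelUpperHalfSpace 1).indicator (ofUHPFun (toCuspFormOfMem F.2)) Z = (F : Matrix (Fin 1) (Fin 1) ℂ → ℂ) Z
    by_cases hZ : Z ∈ siegelUpperHalfSpace 1
    · rw [Set.indicator_of_mem hZ, ofUHPFun_apply_of_mem _ hZ, toCuspFormOfMem_apply, one1_toUHP hZ]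
    · rw [Set.indicator_of_notMem hZ, apply_eq_zero_of_mem_levelSpace F.2.1 hZ]
  right_inv g := by
    apply Subtype.ext
    ext τ
    change (siegelUpperHalfSpace 1).indicator (ofUHPFun (g : CuspForm (kerSL K χ) k)) (one1 (τ : ℂ)) =
      (g : CuspForm (kerSL K χ) k) τ
    rw [Set.indicator_of_mem (one1_coe_mem τ), ofUHPFun_one1]

variable {K k χ}

/-- The values of `cuspLevelSpaceCharEquiv K k χ F`: `τ ↦ F((τ))`. [cite: AndrianovZhuravlev2015, Ch. 2 §3.5 (p0079)] -/
@[simp] theorem cuspLevelSpaceCharEquiv_apply (F : cuspLevelSpaceChar K k χ) (τ : ℍ) :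
    ((cuspLevelSpaceCharEquiv K k χ F : cuspFormCharSubspace K k χ) : CuspForm (kerSL K χ) k) τ =
      (F : Matrix (Fin 1) (Fin 1) ℂ → ℂ) (one1 (τ : ℂ)) :=
  rfl

variable (K k χ) in
/-- **`dim 𝔑_k(K, χ) = dim S_k(Γ(K, χ))^{(K, χ)}`.** [cite: AndrianovZhuravlev2015, Ch. 2 §3.5 (p0079); §4.3 Theorem 4.5 (p0089)] [cite: DiamondShurman2005, §4.3 (p. 119)] -/
theorem finrank_cuspLevelSpaceChar_eq_finrank_cuspFormCharSubspace :
    Module.finrank ℂ (cuspLevelSpaceChar K k χ) = Module.finrank ℂ (cuspFormCharSubspace K k χ) :=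
  (cuspLevelSpaceCharEquiv K k χ).finrank_eq

end Cusp

end SiegelModularForm

end Literature.NumberTheory.ModularForms

end
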